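import Literature.MathematicalPhysics.QuantumFieldTheory.Balaban1983to89.Node00.CarriersY
import Literature.MathematicalPhysics.QuantumFieldTheory.Balaban1983to89.B11Thm1CarrierTReg
import Literature.MathematicalPhysics.QuantumFieldTheory.Balaban1983to89.B11Thm1CarrierTLevelZero
import Literature.MathematicalPhysics.QuantumFieldTheory.Balaban1983to89.B11LeafUnpinnedRecord

/-!
# NODE 00 (YM-PLAN Track A) — STAGE 3′(Z) OF THE CARRIERS OF RECORD: the [Balaban1985Variational] bundle `Z` with its THEOREM-1 FAMILY PINNED to n07-a's
# carrier `B11Thm1CarrierT.varProblemT` AT NODE 00's OBJECTS over print's whole family index (every approximation `K`, every level `k ≤ K`, no holes), the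
# Props 7–8 ∕ Sect. F family pinned to the SAME problems with the orbit relation of record; (9)–(10)'s regularity data, the criticality predicate, the Props 2–6 ∕
# Prop. 9 carriers and the inter-paper constants carried as ONE explicit residual datum `ResidZ`; the pin UP-SIDE; the cumulative record predicate
# `IsRecordOfRecord₉CB10YZ → ₉CB10Y → ₉CB10 → ₉C`; what the [B11] leaf at such a record FEEDS NODE 00's Stage-₈ letters `UkExistsR ∕ UniqueUkOrbitR` at `regB11`

NODE 00 CARRIER MODULE, third pin (seat `pub-ymgap-node00-def` g30, 2026-08-26; design `HOME/pub-ymgap-node00-def/STAGE10-CARRIERS-DESIGN-g29.md` §2 row «Z»; inputs =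
seat dag-n07-a's (KNIT-BY-NAME seat of N07 ∕ interim typer «def-Z», director-ym LINE №35) `B11Thm1CarrierT` (p417210), `B11Thm1CarrierTReg` (p419982),
`B11Thm1CarrierTLevelZero` (p418320), `B11LeafUnpinnedRecord` (p416215) and the pin list `HOME/pub-ymgap-dag-n07-a/B11-PIN-SOCKET.md` §3∕§6∕§7).  APPEND-ONLY: a NEW
importing module; `CarriersY`, `CarriersB10`, `Record9`, n07-a's and def-B's modules untouched and CONSUMED BY NAME.  [Balaban1985Variational] = T. Bałaban, *The
variational problem and background fields in renormalization group method for lattice gauge theories*, Commun. Math. Phys. **102** (1985) 277–309 (cell paper B11).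

WHAT IS PINNED.  In `Residual₅.Z P : PrintedCarriers11` EVERYTHING was free data — N07 was UNDETERMINED over every record predicate so far
(`B11LeafUnpinnedRecord.b11_main_undetermined_over_record₅C ∕ ₈C`).  At a record of THIS module `Z P` IS `Z11OfRecord F N ζ` (the same bundle at every run; print's
family index «(k; {Ω_j}; 𝔅_k; torus)» = `ZIdx` = every approximation `K` of the four-torus family and every level `k ≤ K`, holes absent — Theorem 1's constants
«depend on d and L only», i.e. are chosen BEFORE the member, as typed in `B11.Thm1Printed`), with: THE THEOREM-1 FAMILY `famV ⟨K, k, _⟩ := varProblemT F N K k (ζ.R _)`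
((2) = n01-b's `InUkClassB11`, (3) = `Ū^k = V` for `avOfRecord`, (7) = `PlaqSmall`, «minimal orbit in (8)» = `IsBackground … {InUkClassB11 …} k V U`, «unique critical
orbit in (6)» in n07-a's declared reading D-n07a-1 — OBJECTS OF RECORD); THE PROPS 7–8 ∕ SECT. F FAMILY `famX` = the SAME problems + `SameOrbit := B12GaugeOrbits021.OrbitRel k`
(print's group (4); an OBJECT) + a RESIDUAL criticality predicate `ζ.IsCrit`.  WHAT STAYS RESIDUAL, EXPLICITLY (`ResidZ`, quantified with the record's parameters,
no law assumed): (a) the regularity data `R` of (9)–(10) (`RegCarrierT`: cube class + four gauge-FIXED norm functionals — n07-a's finding F8: the gauge of (9)–(10) is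
the Landau gauge of [Balaban1985RegularSpaces] Thm 2 on `(U′_k, 1)`, (152) p. 301, so an object-level pin is DOWNSTREAM of N05's objects; def-Z's
`B11Reg910Classes.Reg910T` types print's ∃u-sentence, which `B11.VarProblem`'s interface cannot consume); (b) `IsCrit`; (c) the Props 2–6 family `famLG` (Sects. A–E;
MODEL families only today — n07-b's `B11Prop6Concrete.SectEDatum.toLGData` is the object-level FRAME of its Sect.-E slice, for a successor module); (d) the Prop. 9 family
`famAn`; (e) the twelve constants the leaf shares across Props 2–9 (`C₁ = L³` of (14) and `B₅ = 6B₁B₃C₁` of (173) are print's dictionary — recorded, not imposed).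

CONSEQUENCE, SAID (pub-ymgap R433 species; kernel form in §1): at a record of this module the `b11` leaf IS `B11Leaf (Z11OfRecord F N ζ)`
(`leaf_b11_iff_of_isRecordOfRecord₉CB10YZ`); its conjunct `t1` is THEOREM 1 AT NODE 00's OBJECTS over the whole family, read through the residual `R`: the clauses
(8) and «uniqueness in (6)» are GENUINE (at `k = 0` n07-a's theorem, here `famV_levelZero_exists8_unique6`; at `k ≥ 1` Bałaban's Theorem 1 = GAPS G₈a-1∕2, proved
nowhere in the tree) and FEED def-B's Stage-₈ letters at the (2)-class BY NAME (`G8a_of_b11Leaf_Z11OfRecord`); the clause (9)–(10) and `p2 … p9`, `sF` read residual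
data and are CLOSABLE AND REFUTABLE BY JUNK (`exists_residZ_not_b11Leaf`) — so N07 is NOT bookable over this predicate in ∀-form, while its ∃-form is no longer
junk-closable.
THE PIN IS UP-SIDE and CUMULATIVE: `Stage5Params.pinZ` replaces `res.Z` only (datum and the `b8 ∕ b9 ∕ b10` leaves unchanged); the record predicate applies it ON TOP
of the [B10] and [B9] pins (`Stage9Params.viewB10YZ`), refines `IsRecordOfRecord₉CB10Y` WITH THE SAME DATUM AND WORLD, and is inhabited exactly when `₉C` is.
HONEST FRAMING: definitions + kernel bookkeeping; NO estimate; nothing of [Balaban1985Variational] asserted; N07 NOT discharged; counts unmoved; one finite T⁴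
programme at fixed ε — NOT continuum ∕ ℝ⁴ ∕ infinite volume ∕ OS ∕ mass gap ∕ Clay.  No `sorry`, no `axiom`, no `opaque`, no `instance`, no `notation`. -/

noncomputable section

namespace Literature.MathematicalPhysics.QuantumFieldTheory.Balaban1983to89.Node00

open T4Continuum AveragingRT T4FiniteEpsInhabited FlowStep FlowStepRuns DagBinding T4DatumAssembly
open B12GaugeOrbits021 (OrbitRel)
open B11Thm1 (Exists8 Unique6 Thm1At)
open B11Thm1CarrierT (RegCarrierT varProblemT)
open scoped Matrix.Norms.L2Operator

/-! ## §1. Print's family index, the residual layer of the [B11] group, the bundle of record and what its leaf says -/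

section Bundle

variable (F : T4Family) (N : ℕ) [NeZero N]

/-- **Print's family index for Theorem 1 and Props 2–9 at NODE 00's objects**: the torus of the `K`-th approximation of the four-torus family and a
level `k ≤ K` (`k` averaging steps from spacing `L^{−K}`; no holes `Ω_j = T`).  Theorem 1's constants are chosen BEFORE the member («depend on d and L
only»). [cite: Balaban1985Variational, Thm 1 p.279 («a sequence of domains … 𝔅_k … η = L^{−k}»: the family)] -/
structure ZIdx where
  /-- the approximation index (the member lives on the finest torus of `F.P K`) and the level (number of averaging steps) -/
  (K k : ℕ)
  /-- levels do not exceed the approximation's depth -/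
  hk : k ≤ K

/-- **THE RESIDUAL LAYER of the [B11] group at NODE 00's objects** (data, no law): the regularity data `R` of (9)–(10) per member (cube class and the four
gauge-fixed norm functionals — interface finding F8), the criticality predicate of Props 7–8 ∕ Sect. F per member, the Props 2–6 carrier family (Sects. A–E,
Landau-gauge analysis), the Prop. 9 carrier family (Sect. G), and the twelve constants the leaf shares across Props 2–9.
[cite: Balaban1985Variational, (9)–(10) p.279, Props 2–9 pp.281–309 (the data the typed statements read)] -/
structure ResidZ where
  /-- (9)–(10): cube class and local-gauge norms on the finest torus of the `K`-th approximation, per member -/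
  R : ∀ i : ZIdx, RegCarrierT F N i.K
  /-- «U is a critical configuration of (5) on 𝔅_k(V)» (Props 7–8, Sect. F), per member -/
  IsCrit : ∀ i : ZIdx, GaugeField (F.P i.K) i.k (SU N) → GaugeField (F.P i.K) 0 (SU N) → Prop
  /-- the Props 2–6 carriers (Sects. A–E) -/
  famLG : ZIdx → B11.LGData
  /-- the Prop. 9 carriers (Sect. G) -/
  famAn : ZIdx → B11.AnData
  /-- `B₀` ([Balaban1985BackgroundPropagators] Thm 3.13, (117)), `B₁` ([Balaban1985RegularSpaces] Thm 2 ∕ Prop. 3), `B₃` ((162)), `B₅ = 6B₁B₃C₁` ((173)) -/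
  (B₀ B₁ B₃ B₅ : ℝ)
  /-- `C₁` ((14), `= L³` p.280), `C₂`, `C₃` ([Balaban1985Averaging] Props 4–5) -/
  (C₁ C₂ C₃ : ℝ)
  /-- `c₁` ([Balaban1985RegularSpaces] Thm 2), `c₁(½)` (scale sum at rate `½δ₀`), `c₄` ([Balaban1985Averaging] Prop. 4), `δ₀` (decay rate of `H`), `β₀` (Hölder range) -/
  (c₁ c1h c₄ δ₀ β₀ : ℝ)

/-- **THE THEOREM-1 FAMILY OF RECORD**: member `⟨K, k, _⟩` ↦ n07-a's carrier `varProblemT F N K k (ζ.R ⟨K, k, _⟩)` — [B11] (2)–(8) at NODE 00's objects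
(`InUkClassB11`, `avOfRecord`, `PlaqSmall`, `IsBackground`, `OrbitRel`), (9)–(10) read through the residual `R`. [cite: Balaban1985Variational, (2)–(8) p.278, Thm 1 p.279] -/
def famVOfRecord (ζ : ResidZ F N) (i : ZIdx) : B11.VarProblem :=
  varProblemT F N i.K i.k (ζ.R i)

/-- **THE PROPS 7–8 ∕ SECT. F FAMILY OF RECORD**: the SAME variational problem extended by `SameOrbit := OrbitRel k` (print's group (4) = the residual
gauge group of level `k`, an OBJECT) and the residual criticality predicate `ζ.IsCrit`. [cite: Balaban1985Variational, (4)–(6) p.278, Props 7–8 pp.299–300, Sect. F pp.301–305] -/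
def famXOfRecord (ζ : ResidZ F N) (i : ZIdx) : B11.VarProblemX :=
  { toVarProblem := varProblemT F N i.K i.k (ζ.R i)
    IsCritical := ζ.IsCrit i
    SameOrbit := fun U U' => OrbitRel i.k U U' }

/-- **THE [B11] CARRIER BUNDLE OF RECORD** at the residual layer `ζ`: index `ZIdx`, Theorem-1 family and Props-7–8∕Sect.-F family AT NODE 00's OBJECTS, the
Props 2–6 ∕ Prop. 9 families and the constants from `ζ`. [cite: Balaban1985Variational, Thm 1 p.279 + Props 2–9 pp.281–309 (the carriers of the typed statements)] -/
def Z11OfRecord (ζ : ResidZ F N) : PrintedCarriers11 :=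
  { I11 := ZIdx, famV := famVOfRecord F N ζ, famLG := ζ.famLG, famX := famXOfRecord F N ζ, famAn := ζ.famAn,
    B₀ := ζ.B₀, B₁ := ζ.B₁, B₃ := ζ.B₃, B₅ := ζ.B₅, C₁ := ζ.C₁, C₂ := ζ.C₂, C₃ := ζ.C₃,
    c₁ := ζ.c₁, c1h := ζ.c1h, c₄ := ζ.c₄, δ₀ := ζ.δ₀, β₀ := ζ.β₀ }

/-- The bundle's Theorem-1 family IS n07-a's carrier at NODE 00's objects, member by member (`rfl`). [cite: Balaban1985Variational, Thm 1 p.279 (bookkeeping)] -/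
theorem Z11OfRecord_famV (ζ : ResidZ F N) (i : ZIdx) : (Z11OfRecord F N ζ).famV i = varProblemT F N i.K i.k (ζ.R i) := rfl

/-- The family index is inhabited (member `K = k = 0`) — the leaf over it is NOT vacuous. [cite: Balaban1985Variational, Thm 1 p.279 (bookkeeping)] -/
theorem nonempty_zIdx : Nonempty ZIdx := ⟨⟨0, 0, le_rfl⟩⟩

variable {F N}

/-- **THE `t1` CONJUNCT OF THE LEAF AT THE BUNDLE OF RECORD IS THEOREM 1 OVER THE FAMILY AT NODE 00's OBJECTS** — one block of constants with
`B11Thm1.Thm1At` at every member (n07-a's `thm1Printed_iff_thm1At`; the object-level sentence is his `objects_of_thm1Printed (·.K) (·.k) ζ.R h.t1`).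
[cite: Balaban1985Variational, Thm 1 p.279 («will be proved by induction with respect to k»)] -/
theorem exists_thm1At_of_b11Leaf_Z11OfRecord {ζ : ResidZ F N} (h : B11Leaf (Z11OfRecord F N ζ)) :
    ∃ C : B11Thm1.Consts, ∀ i : ZIdx, Thm1At C (varProblemT F N i.K i.k (ζ.R i)) :=
  (B11Thm1CarrierT.thm1Printed_iff_thm1At (fun i : ZIdx => i.K) (fun i => i.k) ζ.R).1 h.t1

/-- **THE G₈a FEED, BY NAME**: the leaf at the bundle of record gives def-B's Stage-₈ letters AT THE (2)-CLASS — solvability `UkExistsR` (G₈a-1) and orbit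
uniqueness `UniqueUkOrbitR` (G₈a-2) of `Node00/BackgroundActionReg` at `𝓡 := regB11`, every approximation `K`, level `k ≤ K`, radius `B₃ε₁` for `0 < ε₁ ≤ a₁`,
every `V` with (7) (n07-a's bridge `B11Thm1CarrierTReg.thm1At_socket_gives_G8a`). [cite: Balaban1985Variational, Thm 1 p.279; Balaban1987RG1, (1.1)–(1.2) p.260] -/
theorem G8a_of_b11Leaf_Z11OfRecord {ζ : ResidZ F N} (h : B11Leaf (Z11OfRecord F N ζ)) :
    ∃ C : B11Thm1.Consts, ∀ (K k : ℕ), k ≤ K → ∀ ε₁ : ℝ, 0 < ε₁ → ε₁ ≤ C.a₁ → ∀ V : GaugeField (F.P K) k (SU N), PlaqSmall ε₁ V →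
      UkExistsR F N (regB11 F N) K k (C.B₃ * ε₁) V ∧ UniqueUkOrbitR F N (regB11 F N) K k (C.B₃ * ε₁) V := by
  obtain ⟨C, hC⟩ := exists_thm1At_of_b11Leaf_Z11OfRecord h
  exact ⟨C, fun K k hk ε₁ h₁ h₂ V hV => B11Thm1CarrierTReg.thm1At_socket_gives_G8a (ζ.R ⟨K, k, hk⟩) C (hC ⟨K, k, hk⟩) h₁ h₂ V hV⟩

/-- **GENUINE, NOT VACUOUS — the level-0 members of the family of record meet (8) ∧ «uniqueness in (6)» OUTRIGHT** (`B₃ = 7`, any `a₀`; n07-a's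
`B11Thm1CarrierTLevelZero.exists8_and_unique6_levelZero` BY NAME): the clauses of `t1` that read objects are theorems at `k = 0` and Bałaban's Theorem 1 at `k ≥ 1`.
[cite: Balaban1985Variational, Thm 1 p.279 (`k = 0`)] -/
theorem famV_levelZero_exists8_unique6 (ζ : ResidZ F N) (K : ℕ) (a₀ : ℝ) {ε₁ : ℝ} (hε₁ : 0 < ε₁) (V : GaugeField (F.P K) 0 (SU N))
    (hV : PlaqSmall ε₁ V) :
    Exists8 (varProblemT F N K 0 (ζ.R ⟨K, 0, Nat.zero_le K⟩)) 7 ε₁ V ∧ Unique6 (varProblemT F N K 0 (ζ.R ⟨K, 0, Nat.zero_le K⟩)) a₀ 7 ε₁ V :=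
  B11Thm1CarrierTLevelZero.exists8_and_unique6_levelZero K _ a₀ hε₁ V hV

variable (F N) in
/-- **THE ∀-FORM IS JUNK-REFUTABLE THROUGH THE RESIDUAL REGULARITY DATA** (R433 species, kernel form): the residual layer every member of which has ONE cube of
size parameter `0` that is NEVER gaugeable (trivial one-point Props 2–6 ∕ Prop. 9 carriers, zero constants — a DEGENERATE datum, not an object of record) makes
the leaf FAIL: Theorem 1 at the member `K = k = 0`, `ε₁ := a₁`, `V := 1` ((7) by n07-a's `reg7_one`) produces a minimiser, for which (9)–(10) on that cube is
demanded (`0 ≤ M(a₁)`) and is false.  So a pin of `R` by genuine cube data (F8) must precede any ∀-form booking of N07.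
[cite: Balaban1985Variational, Thm 1 (9)–(10) p.279 (bookkeeping: the typed regularity clause reads the residual data)] -/
theorem exists_residZ_not_b11Leaf : ∃ ζ : ResidZ F N, ¬ B11Leaf (Z11OfRecord F N ζ) := by
  let Plg : B11.LGData :=
    ⟨PUnit, PUnit, PUnit, PUnit, PUnit, PUnit, PUnit, 0, 0, 0, fun _ => 0, fun _ => 0, fun _ _ => 0, fun _ _ _ _ => True,
      fun _ _ _ _ => True, fun _ _ _ => True, fun _ _ _ _ => True, fun _ _ _ => True, fun _ _ => True, fun _ _ _ => PUnit.unit,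
      fun _ _ _ => True, fun _ _ => 0, fun _ _ => True, fun _ A => A, fun _ _ => 0, fun _ _ _ _ => 0, fun _ _ => 0, fun _ _ => 0,
      fun _ _ => True, fun _ _ _ => True, fun _ _ _ => PUnit.unit, fun _ _ _ => True, fun _ _ _ => True, fun _ _ _ => True⟩
  let Pa : B11.AnData :=
    ⟨PUnit, PUnit, PUnit, 0, 0, 0, fun _ => 0, fun _ _ => 0, fun _ _ => True, fun _ => 0, fun _ _ => True, fun _ _ => True,
      fun _ _ => True, fun _ _ => True, fun _ _ _ => True, fun _ _ _ _ _ _ => 0⟩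
  let Rbad : ∀ K : ℕ, RegCarrierT F N K := fun _ =>
    ⟨PUnit, fun _ => 0, fun _ => 0, fun _ _ => False, fun _ _ => 0, fun _ _ => 0, fun _ _ _ => 0, fun _ _ => 0⟩
  refine ⟨⟨fun i => Rbad i.K, fun _ _ _ => True, fun _ => Plg, fun _ => Pa, 0, 0, 0, 0, 0, 0, 0, 0, 0, 0, 0, 0⟩, fun hZ => ?_⟩
  obtain ⟨C, hC⟩ := exists_thm1At_of_b11Leaf_Z11OfRecord hZ
  obtain ⟨h8, -, h910⟩ :=
    hC ⟨0, 0, le_rfl⟩ C.a₁ C.a₁_pos le_rfl (1 : GaugeField (F.P 0) 0 (SU N)) (B11Thm1CarrierT.reg7_one (Rbad 0) C.a₁_pos)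
  obtain ⟨U, -, -, hU⟩ := h8
  exact (h910 U hU PUnit.unit (C.Mfun_pos C.a₁ C.a₁_pos).le).1

variable (F N) in
/-- The residual layer's type is inhabited (by the degenerate datum above — NOT an object of record). [cite: Balaban1985Variational, Props 2–9 pp.281–309 (bookkeeping)] -/
theorem nonempty_residZ : Nonempty (ResidZ F N) :=
  (exists_residZ_not_b11Leaf F N).nonempty

end Bundle

/-! ## §2. The pin on Stage-5 parameters (UP-SIDE) -/

section Pin

variable (F : T4Family) (N : ℕ) [NeZero N]

/-- **The Z pin of a Stage-5 residual**: the run-indexed [B11] bundle := `Z₀` at every run; every other field unchanged. [cite: Balaban1985Variational, Thm 1 p.279 + Props 2–9 pp.281–309 (the objects the leaf `b11` reads)] -/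
def Residual₅.pinZ (r : Residual₅ F N) (Z₀ : PrintedCarriers11) : Residual₅ F N :=
  { r with Z := fun _ => Z₀ }

/-- **The Z pin of Stage-5 parameters**. [cite: Balaban1985Variational, Thm 1 p.279 (objects of record, Stage 3′(Z))] -/
def Stage5Params.pinZ (θ : Stage5Params F N) (Z₀ : PrintedCarriers11) : Stage5Params F N := { θ with res := θ.res.pinZ F N Z₀ }

/-- The pin touches neither admissibility (`Iff.rfl`) … [cite: Balaban1983RegularityDecay, (1.6) p.572 (hypothesis dictionary; bookkeeping)] -/
theorem Stage5Params.pinZ_admissible_iff (θ : Stage5Params F N) (Z₀ : PrintedCarriers11) : (θ.pinZ F N Z₀).Admissible ↔ θ.Admissible := Iff.rfl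

/-- … nor the density tower (induction on `k`) … [cite: Balaban1988Convergent, (0.2) p.244 (bookkeeping)] -/
theorem densOfRecord₅_pinZ (θ : Stage5Params F N) (Z₀ : PrintedCarriers11) (p : B12.RunParams) :
    ∀ k, densOfRecord₅ F N (θ.pinZ F N Z₀) p k = densOfRecord₅ F N θ p k
  | 0 => rfl
  | k + 1 => by
    show θ.res.R p k (TrhoOfRecord F N p.K k (densOfRecord₅ F N (θ.pinZ F N Z₀) p k)) =
      θ.res.R p k (TrhoOfRecord F N p.K k (densOfRecord₅ F N θ p k))
    rw [densOfRecord₅_pinZ θ Z₀ p k]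

/-- … nor the machine … [cite: Balaban1988Convergent, (0.2) p.244 (bookkeeping)] -/
theorem machineOfRecord₅_pinZ (θ : Stage5Params F N) (Z₀ : PrintedCarriers11) : machineOfRecord₅ F N (θ.pinZ F N Z₀) = machineOfRecord₅ F N θ := by
  unfold machineOfRecord₅
  simp only [densOfRecord₅_pinZ]
  rfl

/-- … nor the assembled datum: THE PIN IS UP-SIDE. [cite: Balaban1988Convergent, (0.2) p.244 (bookkeeping)] -/
theorem datumOfRecord₅_pinZ (θ : Stage5Params F N) (Z₀ : PrintedCarriers11) : datumOfRecord₅ F N (θ.pinZ F N Z₀) = datumOfRecord₅ F N θ := by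
  unfold datumOfRecord₅
  rw [machineOfRecord₅_pinZ]

/-- **The `b11` leaf of the C-binding at Z-pinned parameters IS `B11Leaf Z₀`** (`Iff.rfl`: the N-binding's `b11 := B11Leaf Z`). [cite: Balaban1985Variational, Thm 1 p.279 + Props 2–9 pp.281–309 (the leaf `B11Leaf`)] -/
theorem upOfRecord₅C_pinZ_b11_iff (θ : Stage5Params F N) (Z₀ : PrintedCarriers11) (P : B12.RunParams) :
    (upOfRecord₅C F N (θ.pinZ F N Z₀) P).b11 ↔ B11Leaf Z₀ := Iff.rfl

/-- The `b9` leaf is unchanged by the Z pin (`rfl`) — so the [B9] pin's face survives the cumulative pin. [cite: Balaban1985BackgroundPropagators, Thm 3.1 p.397 (bookkeeping)] -/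
theorem upOfRecord₅C_pinZ_b9 (θ : Stage5Params F N) (Z₀ : PrintedCarriers11) (P : B12.RunParams) :
    (upOfRecord₅C F N (θ.pinZ F N Z₀) P).b9 = (upOfRecord₅C F N θ P).b9 := rfl

/-- The `b10` leaf is unchanged by the Z pin (`rfl`) — so the [B10] pin's face survives the cumulative pin. [cite: Balaban1985UV3, Thm 1 p.257 (bookkeeping)] -/
theorem upOfRecord₅C_pinZ_b10 (θ : Stage5Params F N) (Z₀ : PrintedCarriers11) (P : B12.RunParams) :
    (upOfRecord₅C F N (θ.pinZ F N Z₀) P).b10 = (upOfRecord₅C F N θ P).b10 := rfl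

/-- The Z and [B10] pins COMMUTE (`rfl`). [cite: Balaban1985UV3, Thm 1 p.257; Balaban1985Variational, Thm 1 p.279 (bookkeeping)] -/
theorem Stage5Params.pinZ_pinB10 (θ : Stage5Params F N) (Z₀ : PrintedCarriers11) :
    (θ.pinZ F N Z₀).pinB10 F N = (θ.pinB10 F N).pinZ F N Z₀ := rfl

/-- The Z and Y pins COMMUTE (`rfl`). [cite: Balaban1985BackgroundPropagators, Thm 3.1 p.397; Balaban1985Variational, Thm 1 p.279 (bookkeeping)] -/
theorem Stage5Params.pinZ_pinY (θ : Stage5Params F N) (Z₀ : PrintedCarriers11) (Y₀ : PrintedCarriers9X) :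
    (θ.pinZ F N Z₀).pinY F N Y₀ = (θ.pinY F N Y₀).pinZ F N Z₀ := rfl

end Pin

/-! ## §3. The cumulative Stage-9 record with the [B10], [B9] AND [B11] groups pinned: `IsRecordOfRecord₉CB10YZ` -/

section Record9

variable (F : T4Family) (N : ℕ) [NeZero N]

/-- The Z pin of Stage-9 parameters. [cite: Balaban1985Variational, Thm 1 p.279 (bookkeeping)] -/
def Stage9Params.pinZ (θ : Stage9Params F N) (Z₀ : PrintedCarriers11) : Stage9Params F N := { θ with res := θ.res.pinZ F N Z₀ }

/-- Admissibility is unchanged (`Iff.rfl`). [cite: Balaban1987RG1, (1.20)–(1.21) p.264 (hypothesis dictionary; bookkeeping)] -/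
theorem Stage9Params.pinZ_admissible_iff (θ : Stage9Params F N) (Z₀ : PrintedCarriers11) : (θ.pinZ F N Z₀).Admissible ↔ θ.Admissible := Iff.rfl

/-- The Stage-5 view of Z-pinned Stage-9 parameters IS the Z-pinned Stage-5 view (`rfl`: `residualOfStage9` keeps `Z`). [cite: Balaban1988Convergent, p.244 (bookkeeping)] -/
theorem Stage9Params.toStage5_pinZ (θ : Stage9Params F N) (Z₀ : PrintedCarriers11) :
    (θ.pinZ F N Z₀).toStage5 F N = (θ.toStage5 F N).pinZ F N Z₀ := rfl

variable {F N} in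
/-- The provisos transport along the Z pin (field by field). [cite: Balaban1988Convergent, (3.2)–(3.9) pp.265–266; Balaban1989LargeFieldI, (0.3) p.176 (bookkeeping)] -/
theorem Stage9Params.Provisos.pinZ {θ : Stage9Params F N} (h : θ.Provisos) (Z₀ : PrintedCarriers11) : (θ.pinZ F N Z₀).Provisos :=
  ⟨h.intPiece, h.measω, h.measChi, h.zetaUnity, h.zetaAbs, fun p k _ hk => h.rstep p k hk⟩

variable {F N} in
/-- … and back. [cite: Balaban1988Convergent, (3.2)–(3.9) pp.265–266 (bookkeeping)] -/
theorem Stage9Params.Provisos.of_pinZ {θ : Stage9Params F N} {Z₀ : PrintedCarriers11} (h : (θ.pinZ F N Z₀).Provisos) : θ.Provisos :=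
  ⟨h.intPiece, h.measω, h.measChi, h.zetaUnity, h.zetaAbs, fun p k _ hk => h.rstep p k hk⟩

/-- THE PIN IS UP-SIDE at Stage 9: the datum of record is unchanged (`rfl`). [cite: Balaban1989LargeFieldII, Thm 1 + (0.1) pp.355–356 (bookkeeping)] -/
theorem datumOfRecord₉_pinZ (θ : Stage9Params F N) (h : θ.Provisos) (Z₀ : PrintedCarriers11) :
    datumOfRecord₉ F N (θ.pinZ F N Z₀) (h.pinZ Z₀) = datumOfRecord₉ F N θ h := rfl

/-- **The cumulative pinned Stage-5 view** of Stage-9 parameters: pinned by `pinB10`, THEN `pinY (Y9OfRecord …)` (floor `Mstar`, operator layer `ops`), THEN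
`pinZ (Z11OfRecord F N ζ)` — what the world's upstream block is bound over at a record of this module. [cite: Balaban1985Variational, Thm 1 p.279 (objects of record)] -/
def Stage9Params.viewB10YZ (θ : Stage9Params F N) (Mstar : ℕ) (ops : OpsY N θ.toStage3Params Mstar) (ζ : ResidZ F N) : Stage5Params F N :=
  (((θ.toStage5 F N).pinB10 F N).pinY F N (Y9OfRecord N θ.toStage3Params Mstar ops)).pinZ F N (Z11OfRecord F N ζ)

/-- The leaves of the C-binding over the cumulative view, by name: `b11 ↔ B11Leaf (Z11OfRecord F N ζ)`, `b9 ↔ B9LeafX (Y9OfRecord …)`, `b10 ↔ PrintedUV3V N θ.L`.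
[cite: Balaban1985Variational, Thm 1 p.279; Balaban1985BackgroundPropagators, Thms 3.1–3.15 pp.397–432; Balaban1985UV3, Thm 1 p.257 + Thm 2 p.272] -/
theorem upOfRecord₅C_viewB10YZ_leaves (θ : Stage9Params F N) (Mstar : ℕ) (ops : OpsY N θ.toStage3Params Mstar) (ζ : ResidZ F N) (P : B12.RunParams) :
    ((upOfRecord₅C F N (θ.viewB10YZ F N Mstar ops ζ) P).b11 ↔ B11Leaf (Z11OfRecord F N ζ)) ∧
    ((upOfRecord₅C F N (θ.viewB10YZ F N Mstar ops ζ) P).b9 ↔ B9LeafX (Y9OfRecord N θ.toStage3Params Mstar ops)) ∧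
    ((upOfRecord₅C F N (θ.viewB10YZ F N Mstar ops ζ) P).b10 ↔ PrintedUV3V N θ.L) := by
  refine ⟨upOfRecord₅C_pinZ_b11_iff F N _ _ P, ?_, ?_⟩
  · unfold Stage9Params.viewB10YZ
    rw [upOfRecord₅C_pinZ_b9]
    exact upOfRecord₅C_pinY_b9_iff F N _ _ P
  · unfold Stage9Params.viewB10YZ
    rw [upOfRecord₅C_pinZ_b10, upOfRecord₅C_pinY_b10]
    exact upOfRecord₅C_pinB10_b10_iff F N (θ.toStage5 F N) P

/-- **«(D, w) is the record, Stage 9, [B10], [B9] and [B11] groups pinned»** (CUMULATIVE): `IsRecordOfRecord₉CB10Y` VERBATIM except that the upstream block is the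
C-binding at the cumulative view `viewB10YZ θ Mstar ops ζ` for SOME floor, SOME operator layer and SOME residual [B11] layer `ζ` (residual data, quantified with the
record's parameters; no law on them is assumed). [cite: Balaban1985Variational, Thm 1 p.279 + Props 2–9 pp.281–309; Balaban1985BackgroundPropagators, Thms 3.1–3.15 pp.397–432; Balaban1985UV3, Thm 1 p.257 + Thm 2 p.272; Balaban1989LargeFieldII, Thm 1 + (0.1) pp.355–356 (objects of record)] -/
def IsRecordOfRecord₉CB10YZ (D : FiniteEpsData F (SU N)) (w : WorldP) : Prop :=
  ∃ (θ : Stage9Params F N) (h : θ.Provisos) (Mstar : ℕ) (ops : OpsY N θ.toStage3Params Mstar) (ζ : ResidZ F N),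
    θ.Admissible ∧ D = datumOfRecord₉ F N θ h ∧ w.C = D.C ∧ (0 < w.γ ∧ w.γ ≤ θ.γ) ∧ w.L = (θ.L : ℝ) ∧
      ∀ P : B12.RunParams, w.up P = upOfRecord₅C F N (θ.viewB10YZ F N Mstar ops ζ) P

/-- Pointed form. [cite: Balaban1989LargeFieldII, Thm 1 + (0.1) pp.355–356 (bookkeeping)] -/
theorem isRecordOfRecord₉CB10YZ_of_eq (θ : Stage9Params F N) (h : θ.Provisos) (hθ : θ.Admissible) (Mstar : ℕ) (ops : OpsY N θ.toStage3Params Mstar)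
    (ζ : ResidZ F N) (w : WorldP) (hC : w.C = (datumOfRecord₉ F N θ h).C) (hγ : 0 < w.γ ∧ w.γ ≤ θ.γ) (hL : w.L = (θ.L : ℝ))
    (hup : ∀ P, w.up P = upOfRecord₅C F N (θ.viewB10YZ F N Mstar ops ζ) P) :
    IsRecordOfRecord₉CB10YZ F N (datumOfRecord₉ F N θ h) w :=
  ⟨θ, h, Mstar, ops, ζ, hθ, rfl, hC, hγ, hL, hup⟩

/-- **Inhabitation is Stage 9's EXACTLY**: every admissible Stage-9 parameter with its provisos, ANY floor, ANY operator layer and ANY residual [B11] layer give a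
record of this module at some world, any window `0 < γw ≤ θ.γ`. [cite: Balaban1989LargeFieldII, Thm 1 + (0.1) pp.355–356 (bookkeeping)] -/
theorem exists_world_isRecordOfRecord₉CB10YZ (θ : Stage9Params F N) (h : θ.Provisos) (hθ : θ.Admissible) (Mstar : ℕ)
    (ops : OpsY N θ.toStage3Params Mstar) (ζ : ResidZ F N) {γw : ℝ} (hγw : 0 < γw ∧ γw ≤ θ.γ) :
    ∃ w : WorldP, IsRecordOfRecord₉CB10YZ F N (datumOfRecord₉ F N θ h) w ∧ w.γ = γw := by
  obtain ⟨w₀, -, -⟩ := exists_world_isRecordOfRecord₉C F N θ h hθ hγw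
  exact ⟨{ w₀ with
      C := (datumOfRecord₉ F N θ h).C, γ := γw, L := (θ.L : ℝ), one_lt_L := by exact_mod_cast θ.hL.2,
      up := fun P => upOfRecord₅C F N (θ.viewB10YZ F N Mstar ops ζ) P },
    ⟨θ, h, Mstar, ops, ζ, hθ, rfl, rfl, hγw, rfl, fun _ => rfl⟩, rfl⟩

variable {F N}
variable {D : FiniteEpsData F (SU N)} {w : WorldP}

/-- **Refinement `IsRecordOfRecord₉CB10YZ → IsRecordOfRecord₉CB10Y`** (hence `₉CB10`, `₉C`) with THE SAME datum AND world: witness `θ.pinZ (Z11OfRecord F N ζ)` —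
the cumulative view IS the [B10]-then-[B9]-pinned view of the Z-pinned parameters (`rfl`: the pins commute and `toStage5` passes `pinZ` through).
[cite: Balaban1985Variational, Thm 1 p.279 (bookkeeping)] -/
theorem isRecordOfRecord₉CB10Y_of_isRecordOfRecord₉CB10YZ (h : IsRecordOfRecord₉CB10YZ F N D w) : IsRecordOfRecord₉CB10Y F N D w := by
  obtain ⟨θ, hP, Mstar, ops, ζ, hθ, hD, hC, hγ, hL, hup⟩ := h
  refine ⟨θ.pinZ F N (Z11OfRecord F N ζ), hP.pinZ _, Mstar, ops, hθ, ?_, hC, hγ, hL, fun P => ?_⟩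
  · rw [datumOfRecord₉_pinZ]; exact hD
  · rw [hup P]
    rfl

/-- … hence to `IsRecordOfRecord₉C` (and to `IsRecordOfRecord₅C` at Stage 9's shadow). [cite: Balaban1989LargeFieldII, Thm 1 p.355 (bookkeeping)] -/
theorem isRecordOfRecord₉C_of_isRecordOfRecord₉CB10YZ (h : IsRecordOfRecord₉CB10YZ F N D w) : IsRecordOfRecord₉C F N D w :=
  isRecordOfRecord₉C_of_isRecordOfRecord₉CB10Y (isRecordOfRecord₉CB10Y_of_isRecordOfRecord₉CB10YZ h)

/-- The `atWorld` transfer: every world-reading node theorem over `IsRecordOfRecord₅C` holds at every record of this module. [cite: Balaban1989LargeFieldII, Thm 1 p.355 (bookkeeping)] -/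
theorem atWorld_of_isRecordOfRecord₉CB10YZ {X : Dag.Leaves → Prop}
    (h₅ : ∀ (D : FiniteEpsData F (SU N)) (w : WorldP), IsRecordOfRecord₅C F N D w → ∀ P : B12.RunParams, X (leavesP w P))
    (h : IsRecordOfRecord₉CB10YZ F N D w) (P : B12.RunParams) : X (leavesP w P) :=
  atWorld_of_isRecordOfRecord₉C h₅ (isRecordOfRecord₉C_of_isRecordOfRecord₉CB10YZ h) P

/-- **THE THREE PINNED LEAVES AT A RECORD OF THIS MODULE, for ONE parameter package**: `b9 ↔` def-Y's leaf at `Y9OfRecord` (the [B9] face survives),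
`b10 ↔ PrintedUV3V N θ.L` (the [B10] face survives), `b11 ↔ B11Leaf (Z11OfRecord F N ζ)` (the form the N07 faces below and the sister nodes' closers consume).
[cite: Balaban1985Variational, Thm 1 p.279; Balaban1985BackgroundPropagators, Thm 3.1 p.397; Balaban1985UV3, Thm 1 p.257] -/
theorem leaves_b9_b10_b11_iff_of_isRecordOfRecord₉CB10YZ (h : IsRecordOfRecord₉CB10YZ F N D w) :
    ∃ (θ : Stage9Params F N) (Mstar : ℕ) (ops : OpsY N θ.toStage3Params Mstar) (ζ : ResidZ F N), θ.Admissible ∧ w.L = (θ.L : ℝ) ∧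
      ∀ P : B12.RunParams,
        ((leavesP w P).b9 ↔ B9LeafX (Y9OfRecord N θ.toStage3Params Mstar ops)) ∧ ((leavesP w P).b10 ↔ PrintedUV3V N θ.L) ∧
        ((leavesP w P).b11 ↔ B11Leaf (Z11OfRecord F N ζ)) := by
  obtain ⟨θ, -, Mstar, ops, ζ, hθ, -, -, -, hL, hup⟩ := h
  refine ⟨θ, Mstar, ops, ζ, hθ, hL, fun P => ?_⟩
  have hl := upOfRecord₅C_viewB10YZ_leaves F N θ Mstar ops ζ P
  refine ⟨?_, ?_, ?_⟩
  · show (w.up P).b9 ↔ _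
    rw [hup P]; exact hl.2.1
  · show (w.up P).b10 ↔ _
    rw [hup P]; exact hl.2.2
  · show (w.up P).b11 ↔ _
    rw [hup P]; exact hl.1

/-- **THE `b11` LEAF AT A RECORD OF THIS MODULE IS THE [B11] LEAF AT THE BUNDLE OF RECORD**: for the record's residual layer `ζ`,
`(leavesP w P).b11 ↔ B11Leaf (Z11OfRecord F N ζ)` at every run. [cite: Balaban1985Variational, Thm 1 p.279 + Props 2–9 pp.281–309] -/
theorem leaf_b11_iff_of_isRecordOfRecord₉CB10YZ (h : IsRecordOfRecord₉CB10YZ F N D w) :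
    ∃ ζ : ResidZ F N, ∀ P : B12.RunParams, (leavesP w P).b11 ↔ B11Leaf (Z11OfRecord F N ζ) := by
  obtain ⟨θ, Mstar, ops, ζ, -, -, hl⟩ := leaves_b9_b10_b11_iff_of_isRecordOfRecord₉CB10YZ h
  exact ⟨ζ, fun P => (hl P).2.2⟩

/-- **N07 AT A RECORD OF THIS MODULE IS «b8 → b9 → b11»** (n07-a's `B11LeafUnpinnedRecord.b11_main_iff_of_isRecordOfRecord₅C` transferred along
`₉CB10YZ → ₉C → ₅C`-at-the-shadow: `b4 b5 b6 b7` are theorems of the record). [cite: Balaban1985Variational, Thm 1 p.279, Props 2–9 pp.281–309 (bookkeeping: the node at a record)] -/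
theorem b11_main_iff_of_isRecordOfRecord₉CB10YZ (h : IsRecordOfRecord₉CB10YZ F N D w) (P : B12.RunParams) :
    Dag.B11_main (leavesP w P) ↔ ((leavesP w P).b8 → (leavesP w P).b9 → (leavesP w P).b11) :=
  atWorld_of_isRecordOfRecord₉CB10YZ (X := fun ℓ => Dag.B11_main ℓ ↔ (ℓ.b8 → ℓ.b9 → ℓ.b11))
    (fun _ _ h5 P => B11LeafUnpinnedRecord.b11_main_iff_of_isRecordOfRecord₅C h5 P) h P

/-- **N07 AT A RECORD OF THIS MODULE, AT THE BUNDLES OF RECORD**: for one parameter package `(θ, Mstar, ops, ζ)` of the record, at every run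
`Dag.B11_main (leavesP w P) ↔ (b8 → B9LeafX (Y9OfRecord N θ₃ Mstar ops) → B11Leaf (Z11OfRecord F N ζ))` — the [B9] antecedent is def-Y's leaf at the bundle of
record, the conclusion the [B11] leaf at the bundle of record (its `t1` = Theorem 1 at NODE 00's objects). [cite: Balaban1985Variational, Thm 1 p.279, Props 2–9 pp.281–309] -/
theorem b11_main_iff_bundles_of_isRecordOfRecord₉CB10YZ (h : IsRecordOfRecord₉CB10YZ F N D w) :
    ∃ (θ : Stage9Params F N) (Mstar : ℕ) (ops : OpsY N θ.toStage3Params Mstar) (ζ : ResidZ F N), θ.Admissible ∧ w.L = (θ.L : ℝ) ∧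
      ∀ P : B12.RunParams,
        (Dag.B11_main (leavesP w P) ↔
          ((leavesP w P).b8 → B9LeafX (Y9OfRecord N θ.toStage3Params Mstar ops) → B11Leaf (Z11OfRecord F N ζ))) := by
  obtain ⟨θ, Mstar, ops, ζ, hθ, hL, hl⟩ := leaves_b9_b10_b11_iff_of_isRecordOfRecord₉CB10YZ h
  refine ⟨θ, Mstar, ops, ζ, hθ, hL, fun P => ?_⟩
  rw [b11_main_iff_of_isRecordOfRecord₉CB10YZ h P, (hl P).1, (hl P).2.2]

/-- **N06 ∕ N07 «SLOTS» FORM at a record of this module** (shape of `b9_main_of_isRecordOfRecord₉CB10Y_of_slots`): if for every parameter package presenting `(D, w)`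
as a record of this module the [B11] leaf holds at the bundle of record, then `Dag.B11_main` holds at every run (in-edges unused).  The hypothesis quantifies over
the HIDDEN residual layers: honest, and exactly why N07 is not bookable in ∀-form here (`exists_residZ_not_b11Leaf`).
[cite: Balaban1985Variational, Thm 1 p.279, Props 2–9 pp.281–309 (the node's shape `Dag.B11_main`, bookkeeping)] -/
theorem b11_main_of_isRecordOfRecord₉CB10YZ_of_slots (h : IsRecordOfRecord₉CB10YZ F N D w)
    (hZ : ∀ (θ : Stage9Params F N) (hP : θ.Provisos) (Mstar : ℕ) (ops : OpsY N θ.toStage3Params Mstar) (ζ : ResidZ F N), θ.Admissible →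
      D = datumOfRecord₉ F N θ hP → (∀ P, w.up P = upOfRecord₅C F N (θ.viewB10YZ F N Mstar ops ζ) P) → B11Leaf (Z11OfRecord F N ζ))
    (P : B12.RunParams) : Dag.B11_main (leavesP w P) := by
  obtain ⟨θ, hP, Mstar, ops, ζ, hθ, hD, -, -, -, hup⟩ := h
  intro _ _ _ _ _
  show (w.up P).b11
  rw [hup P]
  exact (upOfRecord₅C_pinZ_b11_iff F N _ _ P).2 (hZ θ hP Mstar ops ζ hθ hD hup)

/-- **WHAT N07's LEAF AT A RECORD OF THIS MODULE FEEDS THE STAGE-₈ LAYER, BY NAME**: if the world's `b11` leaf holds at some run, then for the record's residual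
layer the G₈a letters of `Node00/BackgroundActionReg` hold AT THE (2)-CLASS `regB11` — solvability AND orbit-uniqueness of the background-field problem on every
torus of the family, every level `k ≤ K`, radius `B₃ε₁`, `0 < ε₁ ≤ a₁`, every `V` with (7) — with ONE block of Theorem-1 constants.
[cite: Balaban1985Variational, Thm 1 p.279; Balaban1987RG1, (1.1)–(1.2) p.260] -/
theorem G8a_of_leaf_b11_of_isRecordOfRecord₉CB10YZ (h : IsRecordOfRecord₉CB10YZ F N D w) {P : B12.RunParams} (hb : (leavesP w P).b11) :
    ∃ C : B11Thm1.Consts, ∀ (K k : ℕ), k ≤ K → ∀ ε₁ : ℝ, 0 < ε₁ → ε₁ ≤ C.a₁ → ∀ V : GaugeField (F.P K) k (SU N), PlaqSmall ε₁ V →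
      UkExistsR F N (regB11 F N) K k (C.B₃ * ε₁) V ∧ UniqueUkOrbitR F N (regB11 F N) K k (C.B₃ * ε₁) V := by
  obtain ⟨ζ, hζ⟩ := leaf_b11_iff_of_isRecordOfRecord₉CB10YZ h
  exact G8a_of_b11Leaf_Z11OfRecord ((hζ P).1 hb)

end Record9

end Literature.MathematicalPhysics.QuantumFieldTheory.Balaban1983to89.Node00

end
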